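import Summits.QuantumFields.YangMills.Theorems.UnitScaleTiltProp7ComplementaryProjectorBlockDecay
import Summits.QuantumFields.YangMills.Theorems.UnitScaleTiltProp7CoarseGramCoercivity
import HarnessLib

/-!
# Route `UnitScaleTilt`, crux K1 «MinimiserStabilityRegPr» (stmt-QuantumFields-19200), EX row `hGF[Lift]` ∕ `h349[Lift]` (curved member) — **LOD LINE BRICK (L5′-member), FILE B5
# (routeR-w2 g12, LOCATE-L5-GRAMSHELLS 7416633c road (G)): THE β-ROW OF B4 WITH ITS THREE NAMED ROWS DISCHARGED AT `RegPr` — the coarse coercivity `hcoer` ((L4′), px10 g9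
# ✓`coarseGram_coercive`), the lift-norm row `‖ι(Q″λ)‖ ≤ √s‖λ‖` (px5 ✓`normSq_lift_topMean_le`) and `‖G‖ ≤ C_P²` (px5 ✓`norm_le_of_massive_eq`) — so that only the WINDOW (slope `μ`)
# and the GAP (slope `μ′`) remain as hypotheses: the kernel of print's `P = 1 − R_{Q″}(U₀)` decays between coarse blocks with explicit, K-free constants.**

Cell `ym3-torus` (HUMAN RULING D-0037, YM ladder rung R3 — NOT d = 4, NOT infinite volume, NOT a mass gap, NOT Clay).  Width seat `ym-routeR-w2` gen 12 (D-0154 (3c); ★p1 g24 22:38:36Z ∕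
00:40:07Z CHAIR BOOK; ★★OWNER RULINGS №33∕№35).  THEOREMS ONLY (0 `def`, 0 `sorry`); px5 g11's member letters VERBATIM + `G hAG hGA`; `--supports stmt-QuantumFields-19200 --as helper`,
count-neutral.  HONEST LABEL (№33 (6)): curved γ-row ∕ (3.49) supplier line (LOD localisation), the β-row feeding w5 g13's `hK₂` (c) and the (L6) knit; CONDITIONAL only on the window
rows `hδ`∕`hwin` at slope `μ` and the gap `hgap` at slope `μ′ < μ` (numerical smallness of the consumer's slopes against the K-free constants `s`, `C_P²`, `m_B`, `η⁻¹(e^{μη} − 1) ≈ μ`);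
nothing of (3.49), Thm 3.1∕3.3, `h349`, `hGF`, (L5″), (L6), EX ∕ 19200 is proved here; no summit statement is proved by this seat.

THE CONSTANTS (all K-, L-, volume-free at the chair's pin `c₁ = c₀L^{3(K−n)}`): `s = (25∕8)·c₁∕(c₀(L^d)^{K−n})` (`= 25∕8`), `C_T = √s`, `C_P² = C_G = max 2 (16c₀L^{3(K−n)}∕(ac₁))`
(`= max 2 (16∕a)`), `m_B = 2∕((1 + s)(600(27∕4)⁶·c₀L^{3(K−n)}∕c₁ + a))` (`= 16∕(33(600(27∕4)⁶ + a))`).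

WHAT IS PROVED (ns `Summit.QuantumFields.YangMills.Theorems.Prop7ComplementaryProjectorBlockDecay`, continued).
* `norm_lift_topMean_le` (`‖ι(Q″λ)‖ ≤ √s·‖λ‖` on `SiteL2K`), `norm_massive_inverse_le` (`‖G f‖ ≤ C_P²‖f‖`), `coarseCoercivity_pos` (`0 < m_B`),
  ★★★ `norm_inner_sub_projR_blocks_le_of_regPr` (B4's β-row at `RegPr F n K ε₀ U₀`, `n < K`, with `C_T`, `C_G`, `m_B` as above).
* §5 (w5 g13 01:00:30Z (ii)) `mul_exp_neg_mul_le` (`t·e^{−νt} ≤ (2∕ν)e^{−νt∕2}`), `sum_const_mul_exp_neg_mul_tdist_le` (`S₀`: `Σ_Y C·e^{−ν·tdist(X,Y)} ≤ C(2(1+1∕ν))³`),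
  `sum_tdist_mul_const_mul_exp_neg_mul_tdist_le` (`S₁`: `Σ_Y tdist(X,Y)·C·e^{−ν·tdist(X,Y)} ≤ C(2∕ν)(2(1+2∕ν))³`).

References: T. Bałaban, CMP **99** (1985) 389–434 [Balaban1985BackgroundPropagators] ((3.16) p.393, (3.21)–(3.25) p.394, Thm 3.1 (3.46) p.398, (3.49) p.399); CMP **116** (1988) 1–22
[Balaban1988RG2Cluster] ((2.7) p.13); S. Agmon (1982) Ch. 1 [folklore].
-/

set_option autoImplicit false

noncomputable section

open scoped BigOperators Matrix.Norms.L2Operator InnerProductSpace ComplexConjugate Matrix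

namespace Summit.QuantumFields.YangMills.Theorems.Prop7ComplementaryProjectorBlockDecay

open Literature.MathematicalPhysics.QuantumFieldTheory.Balaban1983to89
open Finset
open T4Continuum BlockAveraging
open BlockAveraging (Idx)
open B7Prop1Explicit (U1 disp)
open B5Eq118OneStroke (iterBlockOf iterBlock mem_iterBlock card_iterBlock)
open B10Eq27TorusAxialLog (holT transl)
open B7TransferAnalyticMean (meanCLM)
open B9Eq311L2Pairing (WL2)
open B11Eq103H1Complex (SiteL2K BondL2K projR)
open Summit.QuantumFields.YangMills.Theorems.Prop8Chart (emlIterU)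
open Literature.MathematicalPhysics.QuantumFieldTheory.Balaban1983to89.T3ContinuumYM3Torus
open T3SectALandauChart (eta eta_pos bgUnits)
open T3PrintedRegularMinimiser (RegPr)
open T3PrintedRegularOrbits (sites_eq)
open T3LevelShift (siteShift)
open Summit.QuantumFields.YangMills.Theorems.Prop7SectET3Transport (periodsT3)
open Summit.QuantumFields.YangMills.Theorems.Prop7SectET3HilbertLetters (W₂ toL2 toL2S DL2 DstarL2 covLapSite adjoint_DL2 inner_toL2)
open Summit.QuantumFields.YangMills.Theorems.Prop7SectET3RealCoordSums (inner_toL2S)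
open Summit.QuantumFields.YangMills.Theorems.Prop7MassivePropagatorAgmonLetters (topMean_blockConst_smul inner_toL2S_smul_left norm_toL2S_smul_le normSq_lift_topMean_le)
open Summit.QuantumFields.YangMills.Theorems.Prop7MassivePropagatorCoercive (norm_le_of_massive_eq)
open Summit.QuantumFields.YangMills.Theorems.Prop7CoarseGramCoercivity (coarseGram_coercive)
open Summit.QuantumFields.YangMills.Theorems.Prop7MassiveConjugateResolvent (lift_topMean_weight_eq norm_weight_massive_inverse_sub_le)
open Summit.QuantumFields.YangMills.Theorems.Prop7ComplementaryProjectorColumns (norm_adjoint_le)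
open Summit.QuantumFields.YangMills.Theorems.Prop7GramConjAccretive (gram_inv_entry_decay)
open Summit.QuantumFields.YangMills.Theorems.Prop7SpanProjectorGramForm (gram_eq_conjTranspose_mul_coords triple_sum_exp_le)
open Summit.QuantumFields.YangMills.Theorems.Prop7SiteEntryCoordinates (orthonormal_spike top_le_span_spike inner_spike_toL2S norm_sq_sum_smul_orthonormalBasis)
open Summit.QuantumFields.YangMills.Theorems.Prop7BlockDistanceWeights (exists_blockDistanceWeight sum_exp_neg_mul_tdist_coarse_le tdist_coarse_comm tdist_coarse_triangle)
open Summit.QuantumFields.YangMills.Theorems.Prop7ComplementaryProjectorColumns (isUnit_gram_massive_columns norm_inner_sub_projR_le norm_inner_massive_column_le)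
open Summit.QuantumFields.YangMills.Theorems.Prop7CoarseGramInverseDecay (spike_eq_lift norm_gram_inv_spike_le_exp_neg_tdist)
open Summit.QuantumFields.YangMills.Theorems.Prop7TopMeanAdjointBlockLocal (inner_blockLift_eq_zero_of_disjoint adjoint_apply_eq_zero_off_block)
open Literature.MathematicalPhysics.QuantumFieldTheory.Balaban1983to89.Beta.CombesThomasForm (abs_exp_sub_one_le)

variable (F : T3Family) {n K : ℕ} (h : n ≤ K) {c₀ c₁ : ℝ} [Fact (0 < c₀)] [Fact (0 < c₁)]
  {ε₀ : ℝ} (hε₀ : 0 < ε₀) (hε7 : 10 ^ 7 * (F.L : ℝ) ^ 3 * ε₀ ≤ 1)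
  (U₀ : GaugeField (F.P K) 0 (Matrix.specialUnitaryGroup (Fin 2) ℂ)) (hreg : RegPr F n K ε₀ U₀)
  (Q'' : SiteL2K ℂ 3 (periodsT3 F K) c₀ W₂ →ₗ[ℂ] (Site (F.P K) (K - n) → Matrix (Fin 2) (Fin 2) ℂ))
  (hseq : ∀ lam : Site (F.P K) 0 → Matrix (Fin 2) (Fin 2) ℂ, ∃ ns : (j : ℕ) → Site (F.P K) j → Matrix (Fin 2) (Fin 2) ℂ, ns 0 = lam ∧
      (∀ (j : ℕ) (y : Site (F.P K) (j + 1)), ns (j + 1) y = ns j (emb y) - meanCLM (Idx (F.P K)) (Matrix (Fin 2) (Fin 2) ℂ) fun i : Idx (F.P K) =>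
        ns j (emb y) - ((holT (emlIterU j (bgUnits F K U₀)) (emb y) (stairWord i.2.1 (off i.1)) : (Matrix (Fin 2) (Fin 2) ℂ)ˣ) : Matrix (Fin 2) (Fin 2) ℂ) *
          ns j (transl (emb y) (disp (stairWord i.2.1 (off i.1)))) * (((holT (emlIterU j (bgUnits F K U₀)) (emb y) (stairWord i.2.1 (off i.1)))⁻¹ : (Matrix (Fin 2) (Fin 2) ℂ)ˣ) : Matrix (Fin 2) (Fin 2) ℂ)) ∧
      ns (K - n) = Q'' (toL2S F K c₀ lam))
  (ι : (Site (F.P K) (K - n) → Matrix (Fin 2) (Fin 2) ℂ) →ₗ[ℂ] SiteL2K ℂ 3 (periodsT3 F n) c₁ W₂)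
  (hι : ∀ c, ι c = toL2S F n c₁ (fun z => c (siteShift (sites_eq F n K h) z)))
  (T : SiteL2K ℂ 3 (periodsT3 F n) c₁ W₂ →ₗ[ℂ] SiteL2K ℂ 3 (periodsT3 F K) c₀ W₂)
  (hT : ∀ (l : SiteL2K ℂ 3 (periodsT3 F K) c₀ W₂) (f : SiteL2K ℂ 3 (periodsT3 F n) c₁ W₂), ⟪ι (Q'' l), f⟫_ℂ = ⟪l, T f⟫_ℂ)
  {a : ℝ} (ha : 0 < a)
  (G : SiteL2K ℂ 3 (periodsT3 F K) c₀ W₂ →ₗ[ℂ] SiteL2K ℂ 3 (periodsT3 F K) c₀ W₂)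
  (hAG : ∀ f, covLapSite F n K c₀ U₀ (G f) + (a : ℂ) • T (ι (Q'' (G f))) = f)
  (hGA : ∀ u, G (covLapSite F n K c₀ U₀ u + (a : ℂ) • T (ι (Q'' u))) = u)

/-! ## §4 The three named rows at `RegPr`, and the β-row with them discharged -/

include hseq hι hε₀ hε7 hreg in
/-- **THE LIFT-NORM ROW ON `SiteL2K`**: `‖ι(Q″λ)‖ ≤ √s·‖λ‖`, `s = (25∕8)·c₁∕(c₀(L^d)^{K−n})` — px5 ✓`normSq_lift_topMean_le` read through `hι` and `toL2S`.
[cite: Balaban1985BackgroundPropagators, (3.16) p.393] -/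
theorem norm_lift_topMean_le (l : SiteL2K ℂ 3 (periodsT3 F K) c₀ W₂) :
    ‖ι (Q'' l)‖ ≤ Real.sqrt ((25 / 8) * (c₁ * ((((F.P K).L : ℝ) ^ (F.P K).d) ^ (K - n))⁻¹ / c₀)) * ‖l‖ := by
  obtain ⟨y, rfl⟩ : ∃ y, l = toL2S F K c₀ y := ⟨(toL2S F K c₀).symm l, ((toL2S F K c₀).apply_symm_apply l).symm⟩
  have hc₀ : 0 < c₀ := Fact.out
  have hc₁ : 0 < c₁ := Fact.out
  have hsq := normSq_lift_topMean_le F U₀ Q'' hseq h (c₁ := c₁) hε₀ hε7 hreg y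
  rw [← hι] at hsq
  have h3 : ‖ι (Q'' (toL2S F K c₀ y))‖ ^ 2 ≤ (Real.sqrt ((25 / 8) * (c₁ * ((((F.P K).L : ℝ) ^ (F.P K).d) ^ (K - n))⁻¹ / c₀)) * ‖toL2S F K c₀ y‖) ^ 2 := by
    rw [mul_pow, Real.sq_sqrt (by positivity)]; exact hsq
  exact (pow_le_pow_iff_left₀ (norm_nonneg _) (by positivity) two_ne_zero).1 h3

include hε₀ hε7 hreg hseq hι hT ha hAG in
/-- **`‖G f‖ ≤ C_P²·‖f‖`** — px5 ✓`norm_le_of_massive_eq` at `u = G f` (`hAG`). [cite: Balaban1985BackgroundPropagators, Thm 3.11 p.416] -/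
theorem norm_massive_inverse_le (f : SiteL2K ℂ 3 (periodsT3 F K) c₀ W₂) : ‖G f‖ ≤ (max 2 (16 * c₀ * ((F.L : ℝ) ^ (K - n)) ^ 3 / (a * c₁))) * ‖f‖ :=
  norm_le_of_massive_eq F h hε₀ hε7 U₀ hreg Q'' hseq ι hι T hT ha (G f) f (hAG f)

include ha in
/-- `0 < m_B` for px10's coarse coercivity constant. [folklore] -/
theorem coarseCoercivity_pos : 0 < (2 / ((1 + (25 / 8) * (c₁ * ((((F.P K).L : ℝ) ^ (F.P K).d) ^ (K - n))⁻¹ / c₀)) * (600 * (27 / 4 : ℝ) ^ 6 * (c₀ * ((F.L : ℝ) ^ 3) ^ (K - n) / c₁) + a))) := by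
  have hc₀ : 0 < c₀ := Fact.out
  have hc₁ : 0 < c₁ := Fact.out
  positivity

include hε₀ hε7 hreg hseq hι hT ha hAG hGA in
set_option maxHeartbeats 400000 in
/-- ★★★ **THE β-ROW AT `RegPr`, NAMED ROWS DISCHARGED**: for `n < K`, `u` supported in `B(z)`, `w` in `B(z′)`, slopes `0 ≤ μ′ < μ` with the window at `μ` (`hδ`, `hwin`) and the gap at
`μ′` (`hgap`, written with `C_T = √s`, `C_G = C_P²`, `m_B` of px10 ✓`coarseGram_coercive`):
`‖⟪toL2S u, toL2S w − projR Δ_{U₀} Q″ (toL2S w)⟫‖ ≤ (8C_P²√s·e^{3μ}‖toL2S u‖)(8C_P²√s·e^{3μ}‖toL2S w‖)·(m_B²∕2 − 3ε(μ′)²)⁻¹e^{9μ′}·(4(2(1 + 1∕(μ−μ′)))³)²·e^{−μ′·tdist(z,z′)}` —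
B4 ✓`norm_inner_sub_projR_blocks_le` with `hCTb := norm_lift_topMean_le`, `hGn := norm_massive_inverse_le`, `hcoer := coarseGram_coercive`.
[cite: Balaban1985BackgroundPropagators, Thm 3.1 (3.46) p.398, (3.49) p.399; Balaban1988RG2Cluster, (2.7) p.13] -/
theorem norm_inner_sub_projR_blocks_le_of_regPr (hnK : n < K) {μ μ' : ℝ} (hμ' : 0 ≤ μ') (hμμ' : μ' < μ)
    {δ₁ : ℝ} (hδ₁ : 0 ≤ δ₁)
    (hδ : 3 * ((eta F n K)⁻¹) ^ 2 * (Real.exp (μ * eta F n K) - 1) ^ 2 + a * ((25 / 8) * (c₁ * ((((F.P K).L : ℝ) ^ (F.P K).d) ^ (K - n))⁻¹ / c₀)) * (Real.exp (3 * μ) - 1) ^ 2 ≤ δ₁ ^ 2)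
    (hwin : Real.sqrt (max 2 (16 * c₀ * ((F.L : ℝ) ^ (K - n)) ^ 3 / (a * c₁))) * δ₁ ≤ 1 / 10)
    (hgap : 3 * ((Real.sqrt (max 2 (16 * c₀ * ((F.L : ℝ) ^ (K - n)) ^ 3 / (a * c₁))) * (2 + Real.sqrt (max 2 (16 * c₀ * ((F.L : ℝ) ^ (K - n)) ^ 3 / (a * c₁))))
          * (Real.sqrt 3 * (eta F n K)⁻¹ * (Real.exp (μ' * eta F n K) - 1) + (Real.sqrt 3 * (eta F n K)⁻¹ * (Real.exp (μ' * eta F n K) - 1)) ^ 2 + Real.sqrt a * (Real.sqrt ((25 / 8) * (c₁ * ((((F.P K).L : ℝ) ^ (F.P K).d) ^ (K - n))⁻¹ / c₀))) * (Real.exp (3 * μ') - 1) + a * (Real.sqrt ((25 / 8) * (c₁ * ((((F.P K).L : ℝ) ^ (F.P K).d) ^ (K - n))⁻¹ / c₀))) ^ 2 * (Real.exp (3 * μ') - 1) ^ 2)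
          * (8 * Real.sqrt (max 2 (16 * c₀ * ((F.L : ℝ) ^ (K - n)) ^ 3 / (a * c₁))) + 8 * Real.sqrt (max 2 (16 * c₀ * ((F.L : ℝ) ^ (K - n)) ^ 3 / (a * c₁))) ^ 2)
          * ((Real.sqrt ((25 / 8) * (c₁ * ((((F.P K).L : ℝ) ^ (F.P K).d) ^ (K - n))⁻¹ / c₀))) * (1 + (Real.exp (3 * μ') - 1))) + (max 2 (16 * c₀ * ((F.L : ℝ) ^ (K - n)) ^ 3 / (a * c₁))) * ((Real.sqrt ((25 / 8) * (c₁ * ((((F.P K).L : ℝ) ^ (F.P K).d) ^ (K - n))⁻¹ / c₀))) * (Real.exp (3 * μ') - 1)))) ^ 2 < (2 / ((1 + (25 / 8) * (c₁ * ((((F.P K).L : ℝ) ^ (F.P K).d) ^ (K - n))⁻¹ / c₀)) * (600 * (27 / 4 : ℝ) ^ 6 * (c₀ * ((F.L : ℝ) ^ 3) ^ (K - n) / c₁) + a))) ^ 2 / 2)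
    (z z' : Site (F.P K) (K - n)) (u w : Site (F.P K) 0 → Matrix (Fin 2) (Fin 2) ℂ)
    (hu : ∀ x, iterBlockOf (K - n) x ≠ z → u x = 0) (hw : ∀ x, iterBlockOf (K - n) x ≠ z' → w x = 0) :
    ‖⟪toL2S F K c₀ u, toL2S F K c₀ w - projR (covLapSite F n K c₀ U₀) Q'' (toL2S F K c₀ w)⟫_ℂ‖
      ≤ (8 * (max 2 (16 * c₀ * ((F.L : ℝ) ^ (K - n)) ^ 3 / (a * c₁))) * Real.sqrt ((25 / 8) * (c₁ * ((((F.P K).L : ℝ) ^ (F.P K).d) ^ (K - n))⁻¹ / c₀)) * Real.exp (3 * μ) * ‖toL2S F K c₀ u‖)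
        * (8 * (max 2 (16 * c₀ * ((F.L : ℝ) ^ (K - n)) ^ 3 / (a * c₁))) * Real.sqrt ((25 / 8) * (c₁ * ((((F.P K).L : ℝ) ^ (F.P K).d) ^ (K - n))⁻¹ / c₀)) * Real.exp (3 * μ) * ‖toL2S F K c₀ w‖)
        * (((2 / ((1 + (25 / 8) * (c₁ * ((((F.P K).L : ℝ) ^ (F.P K).d) ^ (K - n))⁻¹ / c₀)) * (600 * (27 / 4 : ℝ) ^ 6 * (c₀ * ((F.L : ℝ) ^ 3) ^ (K - n) / c₁) + a))) ^ 2 / 2 - 3 * ((Real.sqrt (max 2 (16 * c₀ * ((F.L : ℝ) ^ (K - n)) ^ 3 / (a * c₁))) * (2 + Real.sqrt (max 2 (16 * c₀ * ((F.L : ℝ) ^ (K - n)) ^ 3 / (a * c₁))))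
          * (Real.sqrt 3 * (eta F n K)⁻¹ * (Real.exp (μ' * eta F n K) - 1) + (Real.sqrt 3 * (eta F n K)⁻¹ * (Real.exp (μ' * eta F n K) - 1)) ^ 2 + Real.sqrt a * (Real.sqrt ((25 / 8) * (c₁ * ((((F.P K).L : ℝ) ^ (F.P K).d) ^ (K - n))⁻¹ / c₀))) * (Real.exp (3 * μ') - 1) + a * (Real.sqrt ((25 / 8) * (c₁ * ((((F.P K).L : ℝ) ^ (F.P K).d) ^ (K - n))⁻¹ / c₀))) ^ 2 * (Real.exp (3 * μ') - 1) ^ 2)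
          * (8 * Real.sqrt (max 2 (16 * c₀ * ((F.L : ℝ) ^ (K - n)) ^ 3 / (a * c₁))) + 8 * Real.sqrt (max 2 (16 * c₀ * ((F.L : ℝ) ^ (K - n)) ^ 3 / (a * c₁))) ^ 2)
          * ((Real.sqrt ((25 / 8) * (c₁ * ((((F.P K).L : ℝ) ^ (F.P K).d) ^ (K - n))⁻¹ / c₀))) * (1 + (Real.exp (3 * μ') - 1))) + (max 2 (16 * c₀ * ((F.L : ℝ) ^ (K - n)) ^ 3 / (a * c₁))) * ((Real.sqrt ((25 / 8) * (c₁ * ((((F.P K).L : ℝ) ^ (F.P K).d) ^ (K - n))⁻¹ / c₀))) * (Real.exp (3 * μ') - 1)))) ^ 2)⁻¹ * Real.exp (9 * μ'))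
        * (4 * (2 * (1 + 1 / (μ - μ'))) ^ 3) ^ 2
        * Real.exp (-(μ' * (Site.tdist (P := F.P K) z z' : ℝ))) :=
  norm_inner_sub_projR_blocks_le F h hε₀ hε7 U₀ hreg Q'' hseq ι hι T hT ha G hAG hGA hμ' hμμ' hδ₁ hδ hwin (Real.sqrt_nonneg _)
    (norm_lift_topMean_le F h hε₀ hε7 U₀ hreg Q'' hseq ι hι) (by positivity) (norm_massive_inverse_le F h hε₀ hε7 U₀ hreg Q'' hseq ι hι T hT ha G hAG)
    (coarseCoercivity_pos F ha) (coarseGram_coercive F hnK h hε₀ hε7 U₀ hreg Q'' hseq ι hι T hT ha G hAG) hgap z z' u w hu hw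

/-! ## §5 The row sums `S₀`, `S₁` of the β-row (w5 g13's `hS0` ∕ `hS1`, 01:00:30Z (ii)) -/

omit [Fact (0 < c₀)] [Fact (0 < c₁)] in
/-- `t·e^{−νt} ≤ (2∕ν)·e^{−(ν∕2)t}` for every real `t`, `ν > 0` (`x ≤ e^x` at `x = νt∕2`). [folklore] -/
theorem mul_exp_neg_mul_le {ν : ℝ} (hν : 0 < ν) (t : ℝ) :
    t * Real.exp (-(ν * t)) ≤ (2 / ν) * Real.exp (-(ν / 2 * t)) := by
  have h1 : ν / 2 * t ≤ Real.exp (ν / 2 * t) := by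
    have := Real.add_one_le_exp (ν / 2 * t); linarith
  have h2 : t ≤ (2 / ν) * Real.exp (ν / 2 * t) := by
    rw [div_mul_eq_mul_div, le_div_iff₀ hν]
    nlinarith [h1]
  have h3 : Real.exp (-(ν * t)) = Real.exp (-(ν / 2 * t)) * Real.exp (-(ν / 2 * t)) := by
    rw [← Real.exp_add]; ring_nf
  calc t * Real.exp (-(ν * t)) ≤ (2 / ν) * Real.exp (ν / 2 * t) * Real.exp (-(ν * t)) :=
        mul_le_mul_of_nonneg_right h2 (Real.exp_pos _).le
    _ = (2 / ν) * Real.exp (-(ν / 2 * t)) := by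
        have h4 : Real.exp (ν / 2 * t) * Real.exp (-(ν / 2 * t)) = 1 := by
          rw [← Real.exp_add, add_neg_cancel, Real.exp_zero]
        rw [h3, mul_assoc, ← mul_assoc (Real.exp (ν / 2 * t)), h4, one_mul]

omit [Fact (0 < c₀)] [Fact (0 < c₁)] in
/-- **`S₀`: THE ZEROTH MOMENT** `Σ_Y C·e^{−ν·tdist(X,Y)} ≤ C·(2(1 + 1∕ν))³` (first argument fixed; px12 ✓B3 (W2) + (W3) symmetry). [cite: Balaban1985BackgroundPropagators, (3.49) p.399] -/
theorem sum_const_mul_exp_neg_mul_tdist_le {ν : ℝ} (hν : 0 < ν) {C : ℝ} (hC : 0 ≤ C) (X : Site (F.P K) (K - n)) :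
    ∑ Y : Site (F.P K) (K - n), C * Real.exp (-(ν * (Site.tdist X Y : ℝ))) ≤ C * (2 * (1 + 1 / ν)) ^ 3 := by
  rw [← Finset.mul_sum]
  refine mul_le_mul_of_nonneg_left ?_ hC
  calc ∑ Y : Site (F.P K) (K - n), Real.exp (-(ν * (Site.tdist X Y : ℝ)))
      = ∑ Y : Site (F.P K) (K - n), Real.exp (-(ν * (Site.tdist Y X : ℝ))) :=
        Finset.sum_congr rfl fun Y _ => by rw [tdist_coarse_comm F X Y]
    _ ≤ (2 * (1 + 1 / ν)) ^ 3 := sum_exp_neg_mul_tdist_coarse_le F hν X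

omit [Fact (0 < c₀)] [Fact (0 < c₁)] in
/-- **`S₁`: THE FIRST `tdist`-MOMENT** `Σ_Y tdist(X,Y)·(C·e^{−ν·tdist(X,Y)}) ≤ C·(2∕ν)·(2(1 + 1∕(ν∕2)))³` (`t·e^{−νt} ≤ (2∕ν)e^{−νt∕2}`, then `S₀` at `ν∕2`).
[cite: Balaban1985BackgroundPropagators, (3.49) p.399] -/
theorem sum_tdist_mul_const_mul_exp_neg_mul_tdist_le {ν : ℝ} (hν : 0 < ν) {C : ℝ} (hC : 0 ≤ C) (X : Site (F.P K) (K - n)) :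
    ∑ Y : Site (F.P K) (K - n), (Site.tdist X Y : ℝ) * (C * Real.exp (-(ν * (Site.tdist X Y : ℝ))))
      ≤ C * ((2 / ν) * (2 * (1 + 1 / (ν / 2))) ^ 3) := by
  have hstep : ∀ Y : Site (F.P K) (K - n), (Site.tdist X Y : ℝ) * (C * Real.exp (-(ν * (Site.tdist X Y : ℝ))))
      ≤ C * (2 / ν) * Real.exp (-(ν / 2 * (Site.tdist X Y : ℝ))) := by
    intro Y
    have h := mul_exp_neg_mul_le hν (Site.tdist X Y : ℝ)
    calc (Site.tdist X Y : ℝ) * (C * Real.exp (-(ν * (Site.tdist X Y : ℝ))))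
        = C * ((Site.tdist X Y : ℝ) * Real.exp (-(ν * (Site.tdist X Y : ℝ)))) := by ring
      _ ≤ C * ((2 / ν) * Real.exp (-(ν / 2 * (Site.tdist X Y : ℝ)))) := mul_le_mul_of_nonneg_left h hC
      _ = _ := by ring
  calc ∑ Y : Site (F.P K) (K - n), (Site.tdist X Y : ℝ) * (C * Real.exp (-(ν * (Site.tdist X Y : ℝ))))
      ≤ ∑ Y : Site (F.P K) (K - n), C * (2 / ν) * Real.exp (-(ν / 2 * (Site.tdist X Y : ℝ))) := Finset.sum_le_sum fun Y _ => hstep Y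
    _ ≤ C * (2 / ν) * (2 * (1 + 1 / (ν / 2))) ^ 3 :=
        sum_const_mul_exp_neg_mul_tdist_le F (half_pos hν) (mul_nonneg hC (div_nonneg zero_le_two hν.le)) X
    _ = _ := by ring

end Summit.QuantumFields.YangMills.Theorems.Prop7ComplementaryProjectorBlockDecay

end
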